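import Summits.Langlands.Langlands.Statement
import Literature.NumberTheory.Automorphic.LocalComponentBJGenericProofs
import HarnessLib

/-!
# Route IrreducibilityBySelfDuality — `ReciprocityUpToIrreducibilityR` (stmt-Langlands-17925), line `Sketch`:
# the two rigidity GLUE stubs (`--supports` file; no definitions)

The reciprocity datum `Rec : ReciprocityData K` enters the summit's `Corresponds` ONLY through the
class `(Rec.llc v).recGL n (IrrClass.mk πv)` of the local component `πv` of the cuspidal `π` at `v`.
The line reduces the crux R to the `∃ Rec` form plus RIGIDITY of two pinned data on such local
components.  This module proves the two structural reductions of that rigidity, over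
`Summits.Langlands.Langlands.Statement` and Literature only:

* `stub_recRigidityLAlg_of_genericRigidity` (G1): rigidity on GENERIC classes at every place gives
  rigidity on the local components of (L-algebraic) cuspidal `π`, because local components of
  cuspidal Borel–Jacquet data on `GL_n(𝔸_K)` (`n ≥ 1`) are generic — the PROVED theorem
  `CuspidalAutomorphicRepData.exists_isGeneric_of_hasLocalComponentAt` (Shalika 1974 / Cogdell 2004).
  The L-algebraicity hypothesis is not used.
* `stub_genericRigidity_of_local` (G2): a LOCAL rigidity statement for pairs of local Langlands data
  with canonical Artin pins (base field and every finite extension) specialises, at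
  `F := K_v`, `L := Rec.llc v`, `L' := Rec'.llc v`, to generic rigidity of two reciprocity data,
  through the pins `ReciprocityData.llc_isCanonical` / `llc_eps_isCanonical`.

Standard axioms only; no `sorry`.
-/

noncomputable section

set_option linter.dupNamespace false

open scoped MatrixGroups NumberField
open IsDedekindDomain Filter
open Literature.NumberTheory.Automorphic Literature.NumberTheory.GaloisRepresentations
open Summit.Langlands

namespace Summit.Langlands.Langlands.Theorems.ReciprocityUpToIrreducibilityR

/-- **Glue G1: generic rigidity ⇒ rigidity on local components of cuspidal `π`.**  If two
reciprocity data of every number field agree, at every finite place, on every GENERIC class of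
every rank, then they agree on the class of every local component `πv` of every cuspidal `π` on
`GL_n(𝔸_K)` (`n ≥ 1`): such a `πv` is irreducible and smooth (fields of `SmoothIrrep`) and generic
for some continuous non-trivial additive character of `K_v`
(`CuspidalAutomorphicRepData.exists_isGeneric_of_hasLocalComponentAt`, proved in tree).  The
L-algebraicity hypothesis is carried but unused. [cite: Shalika1974, Thm 5.5] -/
theorem stub_recRigidityLAlg_of_genericRigidity :
    (∀ (K : Type) [Field K] [NumberField K] (Rec Rec' : ReciprocityData K) (v : HeightOneSpectrum (𝓞 K)) (n : ℕ)
      (πv : SmoothIrrep (GL (Fin n) (v.adicCompletion K))) (ψ : AddChar (v.adicCompletion K) Circle),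
      ψ.IsContinuousNontrivial → IsGeneric πv.ρ ψ →
        (Rec.llc v).recGL n (IrrClass.mk πv) = (Rec'.llc v).recGL n (IrrClass.mk πv)) →
    ∀ (K : Type) [Field K] [NumberField K] (Rec Rec' : ReciprocityData K) (n : ℕ)
      (hcpt : isCompact_glFiniteIntegralLevel n K), 0 < n →
      ∀ (π : CuspidalAutomorphicRepData n K hcpt), π.1.IsLAlgebraic →
        ∀ (v : HeightOneSpectrum (𝓞 K)) (πv : SmoothIrrep (GL (Fin n) (v.adicCompletion K))),
          π.1.HasLocalComponentAt v πv.ρ →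
            (Rec.llc v).recGL n (IrrClass.mk πv) = (Rec'.llc v).recGL n (IrrClass.mk πv) := by
  intro hU K _ _ Rec Rec' n hcpt hn π _ v πv hloc
  haveI : NeZero n := ⟨hn.ne'⟩
  haveI := πv.isIrreducible
  obtain ⟨ψ, hψ, hgen⟩ :=
    CuspidalAutomorphicRepData.exists_isGeneric_of_hasLocalComponentAt π v πv.ρ πv.isSmooth hloc
  exact hU K Rec Rec' v n πv ψ hψ hgen

/-- **Glue G2: the pins feed a LOCAL rigidity statement.**  If any two local Langlands data over a
non-archimedean local field whose Artin data are canonical (on the base field, and for their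
`ε`-systems at every finite extension) agree on every generic class, then any two reciprocity data
of a number field `K` agree on every generic class at every finite place `v`: instantiate at
`F := K_v`, `L := Rec.llc v`, `L' := Rec'.llc v` with the pins `ReciprocityData.llc_isCanonical`
and `ReciprocityData.llc_eps_isCanonical`. [folklore] -/
theorem stub_genericRigidity_of_local :
    (∀ (F : Type) [Field F] [ValuativeRel F] [TopologicalSpace F] [IsNonarchimedeanLocalField F]
      (L L' : LocalLanglandsDatum F), L.artin.IsCanonical → L'.artin.IsCanonical →
      (∀ (E : Type) [Field E] [ValuativeRel E] [TopologicalSpace E] [IsNonarchimedeanLocalField E]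
        [Algebra F E] [FiniteDimensional F E], (L.eps.artin E).IsCanonical ∧ (L'.eps.artin E).IsCanonical) →
      ∀ (n : ℕ) (π : SmoothIrrep (GL (Fin n) F)) (ψ : AddChar F Circle),
        ψ.IsContinuousNontrivial → IsGeneric π.ρ ψ → L.recGL n (IrrClass.mk π) = L'.recGL n (IrrClass.mk π)) →
    ∀ (K : Type) [Field K] [NumberField K] (Rec Rec' : ReciprocityData K) (v : HeightOneSpectrum (𝓞 K)) (n : ℕ)
      (πv : SmoothIrrep (GL (Fin n) (v.adicCompletion K))) (ψ : AddChar (v.adicCompletion K) Circle),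
      ψ.IsContinuousNontrivial → IsGeneric πv.ρ ψ →
        (Rec.llc v).recGL n (IrrClass.mk πv) = (Rec'.llc v).recGL n (IrrClass.mk πv) := by
  intro hL K _ _ Rec Rec' v n πv ψ hψ hgen
  exact hL (v.adicCompletion K) (Rec.llc v) (Rec'.llc v) (Rec.llc_isCanonical v)
    (Rec'.llc_isCanonical v)
    (fun E _ _ _ _ _ _ => ⟨Rec.llc_eps_isCanonical v E, Rec'.llc_eps_isCanonical v E⟩) n πv ψ hψ hgen

end Summit.Langlands.Langlands.Theorems.ReciprocityUpToIrreducibilityR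

end
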